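import Literature.Computability.Complexity.MurrayWilliams2018Headline
import Literature.Computability.Complexity.Williams2014SatInstanceFP
import Literature.Computability.Complexity.Williams2014Proofs
import Literature.Computability.Complexity.Williams2014Fact31Proofs
import Literature.Computability.Complexity.RootClock
import HarnessLib

/-!
# Murray–Williams 2018, §5 at the exponential level: Williams' machine `B` for SUBEXPONENTIAL
# witness circuits, and `NQP ⊄ ACC⁰` from the easy witness lemma alone

Companion of `MurrayWilliams2018Headline.lean`, which reduces the headline
`MurrayWilliams2018_NQP_not_subset_ACC0 : ¬ (NQP ⊆ ACC0)` (`CircuitLowerBounds.lean`; C. D. Murray,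
R. R. Williams, *Circuit lower bounds for nondeterministic quasi-polytime: an easy witness lemma for
NP and NQP*, STOC 2018, §1.1 and Thm. 1.3) to four hypotheses
(`MurrayWilliams2018_NQP_not_subset_ACC0_of_lemma_4_1_ae_of_machineB`): the Easy Witness Lemma
(`MurrayWilliams2018_lemma_4_1_ae`), Williams' Fact 3.1 (`Williams2014_fact_3_1`, now
`Williams2014_fact_3_1_holds`), Williams' `ACC`-SAT algorithm (`Williams2014_thm_4_1`, now
`Williams2014_thm_4_1_holds`) and `hB` — **Williams' machine `B`** (R. Williams, *Nonuniform ACC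
circuit lower bounds*, J. ACM 61 (2014), proof of Thm. 3.2, pp. 12–13: "`B` first runs the
nondeterministic algorithm `A` of Lemma 3.1 … Then `B` nondeterministically guesses a … circuit
`W` … constructs an `ACC` CIRCUIT SAT instance `D` to verify that `W` is correct … the
satisfiability of `D` can be determined in `O(2ⁿ/nᶜ)` time") **run with witness circuits of
SUBEXPONENTIAL size `a · 2^{⌊n^{1/q}⌋} + a` and the `2^{n - n^ε}`-time `ACC`-SAT algorithm for
`2^{n^ε}`-size circuits** (Murray–Williams 2018, Thm. 5.1 = `MurrayWilliams2018_thm_5_1_holds`), as the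
proof of Murray–Williams' Thm. 1.2 (§5, pp. 14–15) runs it: "guesses a witness circuit `W` of size
`2^{O(log^{k³} n)}` … the assumed nondeterministic GAP `C` UNSAT algorithm can be run on `D`".

This file PROVES `hB` (`MurrayWilliams2018_machineB_subexp`), by re-running the assembly of
`Williams2014MachineB.lean` / `Williams2014SatInstanceFP.lean` (the polynomial-witness machine `B`,
`Williams2014_thm_3_2_machineB_holds`) with three changes, and nothing else:

* the yardstick that cuts the guessed code of `W` is the **root clock**
  `x ↦ ⟨x, 1^{2^{⌊n^{1/r₁}⌋} + 2}⟩` of `RootClock.lean` (`exists_rootClock_machine`) instead of a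
  polynomial clock;
* stage `F` (the polynomial-time function printing the code of the witness-check circuit
  `D = WitnessCheck.circuit G W`) admits a parsed `W` with `s` gates iff
  `W₀ ≤ w ∧ (Nat.size s)^{r₂} ≤ w`, i.e. iff `w ≥ W₀` and `s < 2^{⌊w^{1/r₂}⌋}` (`admQ`; computed on
  binary numerals, `SatCode.admQ_code`), instead of `s ≤ wᵉ + e + w + 2` — so that `D` lies in the
  class on which the subexponential `ACC`-SAT algorithm `AccSatSubexp d m r` is specified
  (`exists_classThreshold`), and only for `w ≥ W₀` (short inputs are answered without the SAT
  call and patched afterwards, `mem_NTIME_of_eqOn`, `VerifierPatching.lean`);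
* the SAT call costs `O(2^{w - ⌊w^{1/r}⌋}) = O(2ⁿ/n)` at width `w = n + c log n + c`
  (`exists_satTimeSubexp_le`) instead of `O(2ʷ/w^{c+1})`.

The roots are staggered `r < r₁ = r + 1 < r₂ = 2 (r₁ + 1) < q = r₂ + 1` (`r` the root of the SAT
algorithm at the depth of `D`; `B` names `q`), so that every comparison is "a polynomial times
`2^{O(⌊n^{1/r'}⌋)}` is eventually below `2^{⌊n^{1/r}⌋}` for `r < r'`"
(`eventually_poly_mul_two_pow_le_two_pow_nthRoot`, from `eventually_mul_nthRoot_le` of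
`NSUBEXPGuardedBall.lean`).

Main results (all proved; no named fact is introduced):

* `MurrayWilliams2018_machineB_subexp` — the hypothesis `hB` of
  `MurrayWilliams2018_NQP_not_subset_ACC0_of_lemma_4_1_ae_of_machineB`, verbatim;
* **`MurrayWilliams2018_NQP_not_subset_ACC0_of_EWL`** — `NQP ⊄ ACC⁰` from the easy witness lemma for
  `NQP` in the form of Lemma 1.3 alone (hypothesis `hEWL` of
  `MurrayWilliams2018_NQP_not_subset_ACC0_of_EWL_of_machineB`);
* **`MurrayWilliams2018_NQP_not_subset_ACC0_of_lemma_4_1_ae`** — `NQP ⊄ ACC⁰` from the single named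
  fact `MurrayWilliams2018_lemma_4_1_ae` (Murray–Williams 2018, Lemma 4.1, a.e. form).

## References

* C. D. Murray, R. R. Williams, *Circuit lower bounds for nondeterministic quasi-polytime: an easy
  witness lemma for NP and NQP*, STOC 2018, 890–901, §1.1, Thm. 1.2–1.3 and their proofs (§5,
  pp. 14–15), Thm. 5.1 [MurrayWilliams2018].
* R. Williams, *Nonuniform ACC circuit lower bounds*, J. ACM 61(1) (2014) 2:1–2:32, proof of
  Thm. 3.2 (pp. 12–13), Thm. 4.1, proof of Thm. 1.1 (pp. 17–18) [Williams2014].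
* S. Arora, B. Barak, *Computational Complexity: A Modern Approach*, CUP 2009, Def. 2.1 and
  §2.1.2 (verifier form of `NTIME`), §1.3 (machine constructions, time-constructible functions)
  [AroraBarak2009].
-/

noncomputable section

namespace Literature.Computability.Complexity

open _root_.Computability Turing Polynomial

/-! ### Arithmetic of integer roots -/

/-- **Every polynomial is eventually below `2^{⌊n^{1/r}⌋}`** (`r ≠ 0`): `p(n) ≤ C 2^{⌊n^{1/(r+1)}⌋} + C`
(`exists_poly_le_two_pow_nthRoot`) and `(C+1) ⌊n^{1/(r+1)}⌋ + (C+1) ≤ ⌊n^{1/r}⌋` eventually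
(`eventually_mul_nthRoot_le`). [folklore] -/
theorem eventually_poly_le_two_pow_nthRoot (p : Polynomial ℕ) {r : ℕ} (hr : r ≠ 0) :
    ∃ N : ℕ, ∀ n : ℕ, N ≤ n → p.eval n ≤ 2 ^ Nat.nthRoot r n := by
  obtain ⟨C, hC⟩ := PolyExistsNTIME.exists_poly_le_two_pow_nthRoot p (Nat.succ_ne_zero r)
  obtain ⟨N₀, hN₀⟩ := eventually_mul_nthRoot_le hr (Nat.lt_succ_self r) (C + 1)
  refine ⟨N₀, fun n hn => ?_⟩
  set ρ' := Nat.nthRoot (r + 1) n with hρ'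
  set ρ := Nat.nthRoot r n with hρ
  have h2 : (C + 1) * ρ' + (C + 1) ≤ ρ := hN₀ n hn
  have h3 : C * 2 ^ ρ' + C ≤ (2 * C) * 2 ^ ρ' := by nlinarith [Nat.one_le_two_pow (n := ρ')]
  have hC1 : 2 * C ≤ 2 ^ (C + 1) := by
    rw [pow_succ]; have : C < 2 ^ C := Nat.lt_two_pow_self; omega
  have h4 : (2 * C) * 2 ^ ρ' ≤ 2 ^ (ρ' + (C + 1)) := by
    rw [pow_add, mul_comm]; exact Nat.mul_le_mul_left _ hC1
  have h5 : ρ' + (C + 1) ≤ ρ := by rw [Nat.succ_mul] at h2; omega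
  exact (hC n).trans (h3.trans (h4.trans (Nat.pow_le_pow_right two_pos h5)))

/-- **A polynomial times `2^{D ⌊n^{1/r₂}⌋ + D}` is eventually below `2^{⌊n^{1/r}⌋}`** for
`0 < r < r₂`. [folklore] -/
theorem eventually_poly_mul_two_pow_le_two_pow_nthRoot (p : Polynomial ℕ) {r r₂ : ℕ} (hr : r ≠ 0)
    (hrr : r < r₂) (D : ℕ) :
    ∃ N : ℕ, ∀ n : ℕ, N ≤ n →
      p.eval n * 2 ^ (D * Nat.nthRoot r₂ n + D) ≤ 2 ^ Nat.nthRoot r n := by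
  have hr₂ : r₂ ≠ 0 := by omega
  obtain ⟨N₁, hN₁⟩ := eventually_poly_le_two_pow_nthRoot p hr₂
  obtain ⟨N₂, hN₂⟩ := eventually_mul_nthRoot_le hr hrr (D + 1)
  refine ⟨max N₁ N₂, fun n hn => ?_⟩
  set ρ₂ := Nat.nthRoot r₂ n with hρ₂
  have h1 : p.eval n ≤ 2 ^ ρ₂ := hN₁ n (le_of_max_le_left hn)
  have h2 : (D + 1) * ρ₂ + (D + 1) ≤ Nat.nthRoot r n := hN₂ n (le_of_max_le_right hn)
  have h3 : ρ₂ + (D * ρ₂ + D) ≤ Nat.nthRoot r n := by rw [Nat.succ_mul] at h2; omega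
  calc p.eval n * 2 ^ (D * ρ₂ + D) ≤ 2 ^ ρ₂ * 2 ^ (D * ρ₂ + D) := Nat.mul_le_mul_right _ h1
    _ = 2 ^ (ρ₂ + (D * ρ₂ + D)) := (pow_add _ _ _).symm
    _ ≤ 2 ^ Nat.nthRoot r n := Nat.pow_le_pow_right two_pos h3

/-- `n ≤ 2^{⌊n/2⌋ + 1}`. [folklore] -/
theorem self_le_two_pow_half_succ (n : ℕ) : n ≤ 2 ^ (n / 2 + 1) := by
  have h : n / 2 < 2 ^ (n / 2) := Nat.lt_two_pow_self
  calc n ≤ 2 * (n / 2) + 1 := by omega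
    _ ≤ 2 * 2 ^ (n / 2) := by omega
    _ = 2 ^ (n / 2 + 1) := by rw [pow_succ]; ring

/-- `2ᵉ ≤ 2ⁿ/n` as soon as `2e + 2 ≤ n`. [folklore] -/
theorem two_pow_le_two_pow_div_of_le {e n : ℕ} (h : 2 * e + 2 ≤ n) : 2 ^ e ≤ 2 ^ n / n := by
  have hn : 0 < n := by omega
  rw [Nat.le_div_iff_mul_le hn]
  have h1 : n ≤ 2 ^ (n - e) :=
    (self_le_two_pow_half_succ n).trans (Nat.pow_le_pow_right two_pos (by omega))
  calc 2 ^ e * n ≤ 2 ^ e * 2 ^ (n - e) := Nat.mul_le_mul_left _ h1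
    _ = 2 ^ n := by rw [← pow_add, Nat.add_sub_cancel' (by omega)]

/-- **`2^{O(⌊n^{1/r}⌋)}` is `O(n + 2ⁿ/n)`** for `r ≥ 2`: `2^{D ⌊n^{1/r}⌋ + D} ≤ K · williamsBound n + K`.
[folklore] -/
theorem exists_two_pow_nthRoot_le_williamsBound {r : ℕ} (hr : 2 ≤ r) (D : ℕ) :
    ∃ K : ℕ, ∀ n : ℕ, 2 ^ (D * Nat.nthRoot r n + D) ≤ K * williamsBound n + K := by
  obtain ⟨N, hN⟩ := eventually_mul_nthRoot_le one_ne_zero (by omega : 1 < r) (2 * D + 2)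
  refine ⟨2 ^ (D * N + D), fun n => ?_⟩
  have hK : 1 ≤ 2 ^ (D * N + D) := Nat.one_le_two_pow
  rcases le_or_gt N n with hn | hn
  · have h1 := hN n hn
    simp only [Nat.nthRoot_one_left, id_eq] at h1
    have hmul : (2 * D + 2) * Nat.nthRoot r n = 2 * (D * Nat.nthRoot r n) + 2 * Nat.nthRoot r n := by
      ring
    have h2 : 2 ^ (D * Nat.nthRoot r n + D) ≤ 2 ^ n / n :=
      two_pow_le_two_pow_div_of_le (by omega)
    calc 2 ^ (D * Nat.nthRoot r n + D) ≤ 2 ^ n / n := h2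
      _ ≤ williamsBound n := Nat.le_add_left _ _
      _ ≤ 2 ^ (D * N + D) * williamsBound n := Nat.le_mul_of_pos_left _ hK
      _ ≤ _ := Nat.le_add_right _ _
  · have hρ : Nat.nthRoot r n ≤ N := (PolyExistsNTIME.nthRoot_le_self (by omega) n).trans hn.le
    calc 2 ^ (D * Nat.nthRoot r n + D) ≤ 2 ^ (D * N + D) :=
          Nat.pow_le_pow_right two_pos (Nat.add_le_add_right (Nat.mul_le_mul_left D hρ) D)
      _ ≤ _ := Nat.le_add_left _ _

/-- **A polynomial times `2^{O(⌊n^{1/r₁}⌋)}` is `O(n + 2ⁿ/n)`** for `r₁ ≥ 3`. [folklore] -/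
theorem exists_poly_mul_two_pow_nthRoot_le_williamsBound (p : Polynomial ℕ) {r₁ : ℕ} (hr₁ : 3 ≤ r₁)
    (D : ℕ) : ∃ K : ℕ, ∀ n : ℕ, p.eval n * 2 ^ (D * Nat.nthRoot r₁ n + D) ≤ K * williamsBound n + K := by
  obtain ⟨N, hN⟩ := eventually_poly_mul_two_pow_le_two_pow_nthRoot p (r := r₁ - 1) (r₂ := r₁)
    (by omega) (by omega) D
  obtain ⟨K₁, hK₁⟩ := exists_two_pow_nthRoot_le_williamsBound (r := r₁ - 1) (by omega) 1
  refine ⟨K₁ + p.eval N * 2 ^ (D * N + D), fun n => ?_⟩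
  set E := p.eval N * 2 ^ (D * N + D) with hE
  rcases le_or_gt N n with hn | hn
  · calc p.eval n * 2 ^ (D * Nat.nthRoot r₁ n + D) ≤ 2 ^ Nat.nthRoot (r₁ - 1) n := hN n hn
      _ ≤ 2 ^ (1 * Nat.nthRoot (r₁ - 1) n + 1) := Nat.pow_le_pow_right two_pos (by omega)
      _ ≤ K₁ * williamsBound n + K₁ := hK₁ n
      _ ≤ _ := by rw [Nat.add_mul]; omega
  · have hρ : Nat.nthRoot r₁ n ≤ N := (PolyExistsNTIME.nthRoot_le_self (by omega) n).trans hn.le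
    calc p.eval n * 2 ^ (D * Nat.nthRoot r₁ n + D) ≤ E :=
          Nat.mul_le_mul (natPoly_eval_mono p hn.le)
            (Nat.pow_le_pow_right two_pos (Nat.add_le_add_right (Nat.mul_le_mul_left D hρ) D))
      _ ≤ _ := by rw [Nat.add_mul]; omega

/-! ### The width `w = n + c log₂ n + c` -/

/-- The width is monotone in `n`. [folklore] -/
theorem succinctWidth_mono_right (c : ℕ) {n n' : ℕ} (h : n ≤ n') :
    succinctWidth c n ≤ succinctWidth c n' := by
  unfold succinctWidth
  have := Nat.mul_le_mul_left c (Nat.log_mono_right (b := 2) h)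
  omega

/-- The width is strictly monotone in `n`. [folklore] -/
theorem succinctWidth_lt_of_lt (c : ℕ) {n n' : ℕ} (h : n < n') :
    succinctWidth c n < succinctWidth c n' := by
  unfold succinctWidth
  have := Nat.mul_le_mul_left c (Nat.log_mono_right (b := 2) h.le)
  omega

/-- `w ≤ n²` for `n ≥ c + 2`. [folklore] -/
theorem succinctWidth_le_sq {c n : ℕ} (hn : c + 2 ≤ n) : succinctWidth c n ≤ n ^ 2 := by
  have hw := succinctWidth_le c n
  have : (c + 1) * n + c ≤ n * n := by nlinarith
  rw [pow_two]; omega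

/-! ### The SAT call at width `w` costs `O(2ⁿ/n)` -/

/-- `2^{n - (log₂ n + 1)} ≤ 2ⁿ/n` (`n ≥ 1`). [folklore] -/
theorem two_pow_sub_log_succ_le_div {n : ℕ} (hn : 1 ≤ n) :
    2 ^ (n - (Nat.log 2 n + 1)) ≤ 2 ^ n / n := by
  rw [Nat.le_div_iff_mul_le (by omega)]
  have h1 : n < 2 ^ (Nat.log 2 n + 1) := Nat.lt_pow_succ_log_self one_lt_two n
  have h2 : Nat.log 2 n + 1 ≤ n := Nat.succ_le_of_lt (Nat.log_lt_self 2 (by omega))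
  calc 2 ^ (n - (Nat.log 2 n + 1)) * n ≤ 2 ^ (n - (Nat.log 2 n + 1)) * 2 ^ (Nat.log 2 n + 1) :=
        Nat.mul_le_mul_left _ h1.le
    _ = 2 ^ n := by rw [← pow_add, Nat.sub_add_cancel h2]

/-- **The subexponential SAT call costs `O(n + 2ⁿ/n)`**: at width `w = succinctWidth c n`,
`2^{w - ⌊w^{1/r}⌋} ≤ K · williamsBound n + K` (`r ≠ 0`; Murray–Williams 2018, proof of Thm. 1.2:
"obtaining yes/no answers in nondeterministic time `O(2^{ℓ - ℓ^ε}) ≤ t(n)/2^{log^ε t(n)}`"; here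
`⌊w^{1/r}⌋` outgrows the `c log₂ n + c` extra inputs, `eventually_log_le_nthRoot`).
[cite: MurrayWilliams2018, Thm. 1.2 (proof, §5)] -/
theorem exists_satTimeSubexp_le (c : ℕ) {r : ℕ} (hr : r ≠ 0) :
    ∃ K : ℕ, ∀ n : ℕ,
      2 ^ (succinctWidth c n - Nat.nthRoot r (succinctWidth c n)) ≤ K * williamsBound n + K := by
  obtain ⟨N, hN⟩ := eventually_log_le_nthRoot (c + 1) (c + 1) hr
  refine ⟨2 ^ succinctWidth c N, fun n => ?_⟩
  have hK : 1 ≤ 2 ^ succinctWidth c N := Nat.one_le_two_pow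
  rcases le_or_gt N n with hn | hn
  · rcases Nat.eq_zero_or_pos n with rfl | hn1
    · have hN0 : N = 0 := by omega
      subst hN0
      calc 2 ^ (succinctWidth c 0 - Nat.nthRoot r (succinctWidth c 0)) ≤ 2 ^ succinctWidth c 0 :=
            Nat.pow_le_pow_right two_pos (Nat.sub_le _ _)
        _ ≤ _ := Nat.le_add_left _ _
    · have h1 := hN n hn
      have h2 : Nat.nthRoot r n ≤ Nat.nthRoot r (succinctWidth c n) :=
        PolyExistsNTIME.nthRoot_mono_right hr (le_succinctWidth c n)
      have hlog : c * Nat.log 2 n ≤ c * Nat.log 2 (n + 1) :=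
        Nat.mul_le_mul_left c (Nat.log_mono_right (Nat.le_succ n))
      have hlog' : Nat.log 2 n ≤ Nat.log 2 (n + 1) := Nat.log_mono_right (Nat.le_succ n)
      have hmul : (c + 1) * Nat.log 2 (n + 1) = c * Nat.log 2 (n + 1) + Nat.log 2 (n + 1) := by ring
      have hw : succinctWidth c n = n + c * Nat.log 2 n + c := rfl
      have h3 : succinctWidth c n - Nat.nthRoot r (succinctWidth c n) ≤ n - (Nat.log 2 n + 1) := by
        omega
      calc 2 ^ (succinctWidth c n - Nat.nthRoot r (succinctWidth c n))
          ≤ 2 ^ (n - (Nat.log 2 n + 1)) := Nat.pow_le_pow_right two_pos h3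
        _ ≤ 2 ^ n / n := two_pow_sub_log_succ_le_div hn1
        _ ≤ williamsBound n := Nat.le_add_left _ _
        _ ≤ 2 ^ succinctWidth c N * williamsBound n := Nat.le_mul_of_pos_left _ hK
        _ ≤ _ := Nat.le_add_right _ _
  · calc 2 ^ (succinctWidth c n - Nat.nthRoot r (succinctWidth c n)) ≤ 2 ^ succinctWidth c n :=
          Nat.pow_le_pow_right two_pos (Nat.sub_le _ _)
      _ ≤ 2 ^ succinctWidth c N := Nat.pow_le_pow_right two_pos (succinctWidth_mono_right c hn.le)
      _ ≤ _ := Nat.le_add_left _ _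

/-! ### Code lengths of subexponential witnesses -/

/-- A cubic bound for `codeLen`: `codeLen w s φ ≤ 7 (w + s + φ + 7)³`. [folklore] -/
theorem codeLen_le_cube (w s φ : ℕ) : MachineB.codeLen w s φ ≤ 7 * (w + s + φ + 7) ^ 3 := by
  unfold MachineB.codeLen
  set X := w + s + φ + 7 with hX
  have hs : s ≤ X := by omega
  have hφ : 2 * φ + 2 ≤ 2 * X := by omega
  have hX7 : 7 ≤ X := by omega
  have h1 : 4 + s * (2 * φ + 2) ≤ 3 * X ^ 2 := by
    have : s * (2 * φ + 2) ≤ X * (2 * X) := Nat.mul_le_mul hs hφ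
    nlinarith
  have h2 : 2 * (w + s + φ) + 14 = 2 * X := by omega
  rw [h2]
  calc 2 + (4 + s * (2 * φ + 2)) * (2 * X) ≤ 2 + 3 * X ^ 2 * (2 * X) := by gcongr
    _ = 2 + 6 * X ^ 3 := by ring
    _ ≤ 7 * X ^ 3 := by nlinarith [Nat.pow_le_pow_left hX7 3]


/-! ### Stage `F` with the subexponential admissibility test -/

/-- **The admissibility test of stage `F`** for a parsed witness circuit with `s` gates on `w`
inputs, at root `q` and threshold `W₀`: `W₀ ≤ w ∧ (Nat.size s)^q ≤ w` — on binary numerals this is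
the test `s < 2^{⌊w^{1/q}⌋}` (`lt_two_pow_nthRoot_of_admQ`, `admQ_of_lt`) together with "the input is
long". [folklore] -/
def admQ (q W₀ w s : ℕ) : Bool := decide (W₀ ≤ w) && decide (Nat.size s ^ q ≤ w)

/-- `admQ` unfolded. [folklore] -/
theorem admQ_eq_true_iff {q W₀ w s : ℕ} : admQ q W₀ w s = true ↔ W₀ ≤ w ∧ Nat.size s ^ q ≤ w := by
  simp [admQ]

/-- Admissible sizes are below `2^{⌊w^{1/q}⌋}` (`q ≠ 0`). [folklore] -/
theorem lt_two_pow_nthRoot_of_admQ {q W₀ w s : ℕ} (hq : q ≠ 0) (h : admQ q W₀ w s = true) :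
    s < 2 ^ Nat.nthRoot q w := by
  obtain ⟨-, hs⟩ := admQ_eq_true_iff.1 h
  have h1 : Nat.size s ≤ Nat.nthRoot q w := (Nat.le_nthRoot_iff hq).2 hs
  exact (Nat.lt_size_self s).trans_le (Nat.pow_le_pow_right two_pos h1)

/-- Sizes below `2^{⌊w^{1/q}⌋}` are admissible when `W₀ ≤ w` (`q ≠ 0`). [folklore] -/
theorem admQ_of_lt {q W₀ w s : ℕ} (hq : q ≠ 0) (hW : W₀ ≤ w) (hs : s < 2 ^ Nat.nthRoot q w) :
    admQ q W₀ w s = true := by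
  rw [admQ_eq_true_iff]
  refine ⟨hW, ?_⟩
  have h1 : Nat.size s ≤ Nat.nthRoot q w := Nat.size_le.2 hs
  calc Nat.size s ^ q ≤ Nat.nthRoot q w ^ q := Nat.pow_le_pow_left h1 q
    _ ≤ w := Nat.pow_nthRoot_le_iff.2 (Or.inl hq)

/-- **Stage `F` at root `q` and threshold `W₀`** (cf. `SatInstanceFn.Spec`, whose size clause
`W.size ≤ wSize e w` is replaced by `admQ q W₀ w W.size`): `F 00 = 00`; on `1 ⟨out, r⟩` with
`out` the printout of a family `G` of circuits over `accBasis m` along `clauseCoordList w`, `F`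
answers `00` or `1 (code of WitnessCheck.circuit G W)` for some circuit `W` on `w` inputs over
`accBasis m` with `acDepth ≤ dW`, admissible size and fan-in at most `|r|` (soundness); and if `r`
is the code of such a `W`, the answer is the latter for this `W` (completeness). [folklore] -/
def SatInstanceFn.SpecQ (m dW q W₀ : ℕ) (F : List Bool → List Bool) : Prop :=
  F [false, false] = [false, false] ∧
  ∀ (w : ℕ) (G : ClauseCoord w → Circuit (Fin w)), (∀ κ, (G κ).IsOver (accBasis m)) →
    (∀ r : List Bool,
      F (true :: boolPair (encodeAccCircuitList m ((clauseCoordList w).map G)) r) = [false, false] ∨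
      ∃ W : Circuit (Fin w), W.IsOver (accBasis m) ∧ W.acDepth ≤ dW ∧ admQ q W₀ w W.size = true ∧
        W.maxFanIn ≤ r.length ∧
        F (true :: boolPair (encodeAccCircuitList m ((clauseCoordList w).map G)) r) =
          true :: encodeAccCircuit m (WitnessCheck.circuit G W)) ∧
    (∀ W : Circuit (Fin w), W.IsOver (accBasis m) → W.acDepth ≤ dW → admQ q W₀ w W.size = true →
      F (true :: boolPair (encodeAccCircuitList m ((clauseCoordList w).map G))
        (encodeAccCircuit m W)) = true :: encodeAccCircuit m (WitnessCheck.circuit G W))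

namespace SatCode

open CodeFP

/-- `Nat.size` on binary numerals (the length of the numeral). [folklore] -/
theorem natSize_code : CodeFP natE natE Nat.size :=
  (strNatLength.comp strOfNat).congr fun n => TM2Pass.length_encodeNat_eq_size n

/-- **The admissibility test on numerals** `(w, s) ↦ admQ q W₀ w s` (comparison, power with a
constant unary exponent, length of a numeral). [folklore] -/
theorem admQ_code (q W₀ : ℕ) : CodeFP (pairE natE natE) bitE (fun p => admQ q W₀ p.1 p.2) := by
  have hw : CodeFP (pairE natE natE) natE (fun p => p.1) := fst natE natE
  have hs : CodeFP (pairE natE natE) natE (fun p => p.2) := snd natE natE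
  have h1 := natLe.comp ((cst (pairE natE natE) natE W₀).pair hw)
  have h2 := natLe.comp
    ((natPow.comp ((natSize_code.comp hs).pair (cst (pairE natE natE) unE q))).pair hw)
  exact (h1.and h2).congr fun p => rfl

/-- **The typed core of stage `F` at root `q`, threshold `W₀`**: as `gCore`, with the size bound of
`validC` set to the number of parsed gates (no constraint) and the admissibility test `admQ q W₀`
on that number. [folklore] -/
def gCoreQ (m dW q W₀ : ℕ) (p : List (List ℕ) × List ℕ) : Bool × List ℕ :=
  let w := (p.1.headD []).headD 0
  let d := deserialize' p.2
  let ok := d.1 && decide (d.2.1 = w) && validC w dW d.2.2.2.length d.2.2.1 d.2.2.2 &&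
    admQ q W₀ w d.2.2.2.length
  (ok, if ok then circuitC' w (famOf p.1) d.2.2.1 (d.2.2.2.map (canonC m)) else [])

/-- **The typed core on codes.** [folklore] -/
theorem gCoreQ_code (m dW q W₀ : ℕ) :
    CodeFP (pairE (rawE (rawE natE)) (rawE natE)) (pairE bitE (rawE natE)) (gCoreQ m dW q W₀) := by
  have hfam : CodeFP (pairE (rawE (rawE natE)) (rawE natE)) (rawE (rawE natE)) (fun p => p.1) :=
    fst _ (rawE natE)
  have hl : CodeFP (pairE (rawE (rawE natE)) (rawE natE)) (rawE natE) (fun p => p.2) :=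
    snd (rawE (rawE natE)) _
  have hw := (rawHeadD natE (d := 0) rfl).comp ((rawHeadD (rawE natE) (d := []) rfl).comp hfam)
  have hd := deserialize'_code.comp hl
  have hout := hd.snd'.snd'.fst'
  have hgs := hd.snd'.snd'.snd'
  have hlen := (natLength gateE).comp hgs
  have hok := ((hd.fst'.and (natEq.comp (hd.snd'.fst'.pair hw))).and
    ((validC_code dW).comp (hw.pair (hlen.pair (hout.pair hgs))))).and
    ((admQ_code q W₀).comp (hw.pair hlen))
  have hcode := circuitC'_code.comp
    (hw.pair ((famOf_code.comp hfam).pair (hout.pair ((map₀ (canonC_code m)).comp hgs))))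
  have h := hok.pair (hok.ite hcode (cst (pairE (rawE (rawE natE)) (rawE natE)) (rawE natE) ([] : List ℕ)))
  exact h.congr fun p => by simp only [gCoreQ]

open Brick

/-- Stage `F` at root `q` as a typed map: codes of the clause circuits and the raw witness string
in, flag and headed code out. [folklore] -/
def gFullQ (m dW q W₀ : ℕ) (p : List (List ℕ) × List Bool) : Bool × List ℕ :=
  gCoreQ m dW q W₀ (p.1, decStr p.2)

/-- `gFullQ` on codes. [folklore] -/
theorem gFullQ_code (m dW q W₀ : ℕ) :
    CodeFP (pairE (listE (listE natE)) strE) (pairE bitE (listE natE)) (gFullQ m dW q W₀) := by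
  have hfam := ((map₀ (rawOfList natE)).comp (rawOfList (listE natE))).comp (fst (listE (listE natE)) strE)
  have hr := decStr_code.comp (snd (listE (listE natE)) strE)
  have hcore := (gCoreQ_code m dW q W₀).comp (hfam.pair hr)
  have h := hcore.fst'.pair ((listOfRaw natE).comp hcore.snd')
  exact h.congr fun p => by simp [gFullQ, List.map_id]

/-- **Stage `F` at root `q` as a string function**: dispatch on the leading bit, the typed map, the
output word. [folklore] -/
theorem exists_stageFQ (m dW q W₀ : ℕ) : ∃ F : List Bool → List Bool, F ∈ FP ∧ F [false, false] = [false, false] ∧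
    ∀ (fam : List (List ℕ)) (r : List Bool),
      F (true :: boolPair (listE (listE natE) fam) r) = outWord (gFullQ m dW q W₀ (fam, r)) := by
  obtain ⟨G, hG, hGs⟩ := gFullQ_code m dW q W₀
  obtain ⟨P, hP, hPs⟩ := outWord_code
  obtain ⟨D, hD, hDs⟩ := (strDrop.comp ((cst strE unE 1).pair (CodeFP.id strE)))
  refine ⟨iteFn (ltFn ∘ fanoutFn (fun _ => []) take1Fn) (P ∘ G ∘ D) (fun _ => [false, false]),
    iteFn_mem_FP (comp_mem_FP ltFn_mem_FP (fanoutFn_mem_FP (const_mem_FP []) take1Fn_mem_FP))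
      (comp_mem_FP hP (comp_mem_FP hG hD)) (const_mem_FP _), ?_, fun fam r => ?_⟩
  · have hc : (ltFn ∘ fanoutFn (fun _ => []) take1Fn) [false, false] = [false] := by
      simp [take1Fn, bitsToNat]
    rw [iteFn_apply hc]
    simp
  · have hc : (ltFn ∘ fanoutFn (fun _ => []) take1Fn) (true :: boolPair (listE (listE natE) fam) r) = [true] := by
      simp [take1Fn, bitsToNat]
    rw [iteFn_apply hc, if_pos rfl, Function.comp_apply, Function.comp_apply]
    have hD1 : D (true :: boolPair (listE (listE natE) fam) r) = boolPair (listE (listE natE) fam) r := by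
      have := hDs (true :: boolPair (listE (listE natE) fam) r)
      simpa using this
    rw [hD1, show boolPair (listE (listE natE) fam) r = pairE (listE (listE natE)) strE (fam, r) from rfl, hGs, hPs]
    rfl

/-- **Stage `F` of the machine `B` at root `q` is polynomial time**: for all parameters there is an
`FP` string function with `SatInstanceFn.SpecQ` (Murray–Williams 2018, proof of Thm. 1.2: the circuit
`D` "can be computed in time" polynomial in the codes of `C_n` and of the guessed `W`).
[cite: MurrayWilliams2018, Thm. 1.2 (proof, §5)] -/
theorem exists_satInstanceFnQ (m dW q W₀ : ℕ) :
    ∃ F : List Bool → List Bool, F ∈ FP ∧ SatInstanceFn.SpecQ m dW q W₀ F := by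
  obtain ⟨F, hF, hF0, hF1⟩ := exists_stageFQ m dW q W₀
  refine ⟨F, hF, hF0, fun w G hG => ?_⟩
  have hout : encodeAccCircuitList m ((clauseCoordList w).map G) = listE (listE natE) (famList m G) := by
    rw [encodeAccCircuitList_eq_listE]; rfl
  have hw := headD_famList m G
  have hfam := famOf_famList m G
  have hlen := length_TC_famC m G
  constructor
  · -- soundness
    intro r
    rw [hout, hF1]
    simp only [outWord, gFullQ, gCoreQ, hw, hfam]
    set d := deserialize' (decStr r) with hd
    by_cases hok : (d.1 && decide (d.2.1 = w) && validC w dW d.2.2.2.length d.2.2.1 d.2.2.2 &&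
        admQ q W₀ w d.2.2.2.length) = true
    · right
      simp only [Bool.and_eq_true, decide_eq_true_eq] at hok
      obtain ⟨⟨⟨hflag, hn⟩, hv⟩, hadm⟩ := hok
      have hdes := deserialize_of_flag hflag
      refine ⟨realize m w dW d.2.2.2.length d.2.2.1 d.2.2.2, realize_isOver hv, acDepth_realize_le hv,
        ?_, ?_, ?_⟩
      · rw [size_realize hv]; exact hadm
      · refine maxFanIn_realize_le hv fun g hg => ?_
        have h1 := arity_le_of_deserialize (n := d.2.1) (out := d.2.2.1) (gs := d.2.2.2) hdes g hg
        have h2 := length_decStr_le r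
        omega
      · rw [if_pos (by simp [hflag, hn, hv, hadm]), if_pos (by simp [hflag, hn, hv, hadm]),
          circuitC'_eq _ _ hlen, circuitC_realize m G hv, encodeAccCircuit_eq_listE]
    · left
      have hok' : (d.1 && decide (d.2.1 = w) && validC w dW d.2.2.2.length d.2.2.1 d.2.2.2 &&
          admQ q W₀ w d.2.2.2.length) = false := by
        simpa using hok
      rw [hok']
      simp
  · -- completeness
    intro W hWB hWd hWadm
    have hsz : W.size ≤ (W.gates.map (gateC m)).length := by rw [List.length_map]; rfl
    obtain ⟨hdes, hv, hcan, hcode⟩ := circuitC_of_circuit m G W hWB hWd hsz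
    have hadm' : admQ q W₀ w (W.gates.map (gateC m)).length = true := by
      rw [List.length_map]; exact hWadm
    rw [hout, hF1, encodeAccCircuit_eq_listE, encodeAccCircuit_eq_listE]
    simp only [outWord, gFullQ, gCoreQ, hw, hfam, decStr_listE, deserialize'_of_some hdes, hv, hadm',
      decide_true, Bool.and_self, if_true, hcan, circuitC'_eq _ _ hlen, hcode]

end SatCode


/-! ### The acceptance relation of `B` at subexponential witness size -/

namespace MachineB

open WitnessCheck

/-- **The acceptance relation of the subexponential machine `B`** on input `x` and (truncated)
certificate `z = ⟨z₁, z₂⟩` (cf. `MachineB.accept`): the generator accepts `⟨x, z₁⟩`, printing the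
clause circuits `G`; stage `F` (`SatInstanceFn.SpecQ m dW q W₀`) answers, on the code `z₂` cut at the
yardstick `Y n`, with the code of the witness-check circuit `circuit G W` for an admissible `W`; and
that instance is unsatisfiable. [cite: Williams2014, proof of Thm. 3.2 (pp. 12–13)] -/
noncomputable def acceptQ (F : List Bool → List Bool) (ok : List Bool → List Bool → Bool)
    (out : List Bool → List Bool → List Bool) (m c dW q W₀ : ℕ) (Y : ℕ → ℕ) (x z : List Bool) : Bool :=
  @decide (∃ (G : ClauseCoord (succinctWidth c x.length) → Circuit (Fin (succinctWidth c x.length)))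
      (W : Circuit (Fin (succinctWidth c x.length))),
    ok x (boolUnpair z).1 = true ∧ (∀ κ, (G κ).IsOver (accBasis m)) ∧
    out x (boolUnpair z).1 =
      encodeAccCircuitList m ((clauseCoordList (succinctWidth c x.length)).map G) ∧
    W.IsOver (accBasis m) ∧ W.acDepth ≤ dW ∧ admQ q W₀ (succinctWidth c x.length) W.size = true ∧
    F (true :: boolPair (out x (boolUnpair z).1) (guardLen (Y x.length) (boolUnpair z).2)) =
      true :: encodeAccCircuit m (circuit G W) ∧
    ¬ (circuit G W).Satisfiable) (Classical.dec _)

/-- `acceptQ = true` unfolded. [folklore] -/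
theorem acceptQ_eq_true_iff {F : List Bool → List Bool} {ok : List Bool → List Bool → Bool}
    {out : List Bool → List Bool → List Bool} {m c dW q W₀ : ℕ} {Y : ℕ → ℕ} {x z : List Bool} :
    acceptQ F ok out m c dW q W₀ Y x z = true ↔
      ∃ (G : ClauseCoord (succinctWidth c x.length) → Circuit (Fin (succinctWidth c x.length)))
        (W : Circuit (Fin (succinctWidth c x.length))),
      ok x (boolUnpair z).1 = true ∧ (∀ κ, (G κ).IsOver (accBasis m)) ∧
      out x (boolUnpair z).1 =
        encodeAccCircuitList m ((clauseCoordList (succinctWidth c x.length)).map G) ∧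
      W.IsOver (accBasis m) ∧ W.acDepth ≤ dW ∧ admQ q W₀ (succinctWidth c x.length) W.size = true ∧
      F (true :: boolPair (out x (boolUnpair z).1) (guardLen (Y x.length) (boolUnpair z).2)) =
        true :: encodeAccCircuit m (circuit G W) ∧
      ¬ (circuit G W).Satisfiable := by
  unfold acceptQ
  exact @decide_eq_true_iff _ (Classical.dec _)

/-- **Soundness of the subexponential `B`** (Williams 2014, p. 13: "if `x ∉ L` then no `W` encodes a
satisfying assignment and every `D` is satisfiable"): an accepted certificate proves `x ∈ L`, on
every input length (`circuit_spec`, `IsSuccinctReduction.mem_iff`). [cite: Williams2014, proof of Thm. 3.2 (pp. 12–13)] -/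
theorem mem_of_acceptQ {c m dG eG dW q W₀ : ℕ} {L : Language Bool} {cl : List Bool → ℕ → Clause ℕ}
    (hred : IsSuccinctReduction c L cl)
    {ok : List Bool → List Bool → Bool} {out : List Bool → List Bool → List Bool}
    (hsound : ∀ x y, ok x y = true → GoodClauseCircuits c cl m dG eG x (out x y))
    {F : List Bool → List Bool} {Y : ℕ → ℕ} {x z : List Bool}
    (hacc : acceptQ F ok out m c dW q W₀ Y x z = true) : x ∈ L := by
  rw [acceptQ_eq_true_iff] at hacc
  obtain ⟨G, W, hok, hGo, hout, hWB, hWd, -, -, hunsat⟩ := hacc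
  obtain ⟨G', hG', hout'⟩ := hsound x _ hok
  have hGG : G' = G :=
    clauseCircuits_eq_of_encode_eq (fun κ => (hG' κ).1) hGo (hout'.symm.trans hout)
  subst hGG
  have hspec := circuit_spec hred x G' (fun κ => (hG' κ).1) (fun κ => (hG' κ).2.1)
    (fun κ => (hG' κ).2.2.1) (fun κ => (hG' κ).2.2.2.1) (fun κ => (hG' κ).2.2.2.2) W hWB hWd le_rfl
  exact (hred.mem_iff x).2 ⟨W.assignment, hspec.2.2.2.2.2.1 hunsat⟩

/-- **Completeness of the subexponential `B` on long inputs** (Williams 2014, p. 13: "if `x ∈ L`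
then some computation path of `B` accepts"; Murray–Williams 2018, §5: "If `1ⁿ ∈ L`, then there is a
`Wₙ` … such that `D` is unsatisfiable"): if every `x ∈ L` has a satisfying assignment of
`succinctCNF c cl x` encoded by an `accBasis m`-circuit of depth `≤ dW` and size
`≤ a · 2^{⌊n^{1/q'}⌋} + a`, then for every `x ∈ L` of length `≥ N₁` some certificate of length
`≤ s x` is accepted — provided that from `N₁` on the threshold `W₀` is passed, the padded and
fan-in–normalised witness (`Circuit.exists_padInputs`, `Circuit.normFanIn`: size `+ w + 2`, fan-in
`≤ m (w + size)`) is below `2^{⌊w^{1/q}⌋}`, and its code (`codeLen`) fits the yardstick `Y n`.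
[cite: Williams2014, proof of Thm. 3.2 (pp. 12–13)] -/
theorem acceptQ_of_mem {c m dG eG dW q q' a W₀ cA N₁ : ℕ} {L : Language Bool}
    {cl : List Bool → ℕ → Clause ℕ} (hred : IsSuccinctReduction c L cl) (hm : 0 < m) (hq : q ≠ 0)
    {ok : List Bool → List Bool → Bool} {out : List Bool → List Bool → List Bool}
    (hsound : ∀ x y, ok x y = true → GoodClauseCircuits c cl m dG eG x (out x y))
    (hcompl : ∀ x, ∃ y, y.length ≤ cA * williamsBound x.length + cA ∧ ok x y = true)
    (hWit : ∀ x ∈ L, ∃ (k : ℕ) (W : Circuit (Fin k)), k ≤ succinctWidth c x.length ∧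
      W.IsOver (accBasis m) ∧ W.acDepth ≤ dW ∧ W.size ≤ a * 2 ^ Nat.nthRoot q' x.length + a ∧
      (succinctCNF c cl x).eval W.assignment = true)
    {F : List Bool → List Bool} (hF : SatInstanceFn.SpecQ m (dW + 3) q W₀ F)
    (Y : ℕ → ℕ)
    (hN₁ : ∀ n, N₁ ≤ n → W₀ ≤ succinctWidth c n ∧
      a * 2 ^ Nat.nthRoot q' n + a + succinctWidth c n + 2 <
        2 ^ Nat.nthRoot q (succinctWidth c n) ∧
      codeLen (succinctWidth c n) (2 ^ Nat.nthRoot q (succinctWidth c n))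
        (m * (succinctWidth c n + 2 ^ Nat.nthRoot q (succinctWidth c n))) ≤ Y n)
    (s : List Bool → ℕ) (hs : ∀ x, 2 * (cA * williamsBound x.length + cA) + 2 + Y x.length ≤ s x)
    {x : List Bool} (hx : x ∈ L) (hxN : N₁ ≤ x.length) :
    ∃ z, z.length ≤ s x ∧ acceptQ F ok out m c (dW + 3) q W₀ Y x z = true := by
  obtain ⟨hW₀, hlt, hcode⟩ := hN₁ x.length hxN
  obtain ⟨yA, hyA, hok⟩ := hcompl x
  obtain ⟨k, W₀', hk, hB₀, hd₀, hs₀, hsat₀⟩ := hWit x hx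
  obtain ⟨W₁, hB₁, hd₁, hs₁, hassign⟩ :=
    Circuit.exists_padInputs (w := succinctWidth c x.length) (acBasis_subset_accBasis m) hk W₀' hB₀
  obtain ⟨W₂, hW₂⟩ : ∃ W₂ : Circuit (Fin (succinctWidth c x.length)), W₂ = W₁.normFanIn m :=
    ⟨_, rfl⟩
  have hB₂ : W₂.IsOver (accBasis m) := hW₂ ▸ Circuit.isOver_normFanIn hB₁
  have hd₂ : W₂.acDepth ≤ dW + 3 := by
    rw [hW₂]
    exact (Circuit.acDepth_normFanIn_le m W₁).trans (by omega)
  have hs₂ : W₂.size < 2 ^ Nat.nthRoot q (succinctWidth c x.length) := by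
    rw [hW₂, Circuit.size_normFanIn]
    omega
  have hadm₂ : admQ q W₀ (succinctWidth c x.length) W₂.size = true := admQ_of_lt hq hW₀ hs₂
  have hφ₂ : W₂.maxFanIn ≤ m * (succinctWidth c x.length +
      2 ^ Nat.nthRoot q (succinctWidth c x.length)) := by
    rw [hW₂]
    refine (Circuit.maxFanIn_normFanIn_le hm hB₁).trans (Nat.mul_le_mul_left m ?_)
    refine Nat.add_le_add_left ?_ _
    have : W₁.size = (W₁.normFanIn m).size := (Circuit.size_normFanIn (m := m) (C := W₁)).symm
    omega
  have hassign₂ : W₂.assignment = W₀'.assignment := by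
    rw [← hassign, hW₂]
    exact Circuit.assignment_congr fun i => Circuit.eval_normFanIn m W₁ i
  have hlen : (encodeAccCircuit m W₂).length ≤ Y x.length :=
    (length_encodeAccCircuit_le m W₂ hs₂.le hφ₂).trans hcode
  refine ⟨boolPair yA (encodeAccCircuit m W₂), ?_, ?_⟩
  · rw [length_boolPair]
    have := hs x
    omega
  · obtain ⟨G, hG, hout⟩ := hsound x yA hok
    rw [acceptQ_eq_true_iff]
    simp only [boolUnpair_boolPair]
    rw [guardLen_of_le hlen]
    refine ⟨G, W₂, hok, fun κ => (hG κ).1, hout, hB₂, hd₂, hadm₂, ?_, ?_⟩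
    · rw [hout]
      exact (hF.2 _ G fun κ => (hG κ).1).2 W₂ hB₂ hd₂ hadm₂
    · have hspec := circuit_spec hred x G (fun κ => (hG κ).1) (fun κ => (hG κ).2.1)
        (fun κ => (hG κ).2.2.1) (fun κ => (hG κ).2.2.2.1) (fun κ => (hG κ).2.2.2.2) W₂ hB₂ hd₂ le_rfl
      rw [hspec.2.2.2.2.2, hassign₂]
      exact hsat₀

end MachineB


/-! ### The core machine of the subexponential `B` and its output -/

namespace MachineB

open WitnessCheck TM2Comp

/-- **The running time of the core machine** on `⟨⟨x, 1^{Y n}⟩, z⟩`, `|z| ≤ Z`, as a function of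
`n = |x|` and `Z` (cf. `coreTime`): stage 1, the generator behind `mapFstAux`, stage 3, stage `F`, the
subexponential SAT call at root `r` with its two wrappers. [folklore] -/
noncomputable def coreTimeQ (C₁ C₃ cA DA cS c eG r : ℕ) (pF : Polynomial ℕ) (Y : ℕ → ℕ) (n Z : ℕ) : ℕ :=
  (C₁ * (4 * n + 6 + 2 * Y n + Z) + C₁) +
  ((cA * (williamsBound n + Z) + cA) +
    3 * (2 * n + 2 + Z + DA * (cA * (williamsBound n + Z) + cA)) + 2 * (4 * n + 6 + 2 * Z + Y n) + 6) +
  (C₃ * (2 * (2 * n + 2 + Z + DA * (cA * (williamsBound n + Z) + cA)) + 2 + Y n) + C₃) +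
  pF.eval (fInLenB c eG n (Y n)) +
  (cS * 2 ^ (succinctWidth c n - Nat.nthRoot r (succinctWidth c n)) + cS + 3)

/-- **The output of the core machine `P₁ ▸ mapFstAux A ▸ P₃ ▸ M_F ▸ compl (flagAux M_SAT)` of the
subexponential `B`** on `⟨⟨x, 1^{Y n}⟩, z⟩`: the bit `acceptQ x z`, within `coreTimeQ … n |z|` steps
(cf. `core_outputsWithin`). The SAT machine — an `AccSatSubexp`-type algorithm at root `r`, specified
on circuits with at most `2^{⌊w^{1/r}⌋}` gates and fan-in — is only ever started on the code of an
instance `circuit G W` with `G` the good clause circuits and `W` admissible (`admQ q W₀ w |W|`, so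
`w ≥ W₀` and `|W| < 2^{⌊w^{1/q}⌋}`; fan-in at most the yardstick `Y n`), which lies in that class by the
threshold hypothesis `hclass`; a rejected generator run, an unparsable or inadmissible witness and
every short input are answered without it. [cite: MurrayWilliams2018, Thm. 1.2 (proof, §5)] -/
theorem core_outputsWithinQ {c m dG eG dW q W₀ r cA C₁ C₃ cS : ℕ} {L : Language Bool}
    {cl : List Bool → ℕ → Clause ℕ} (hred : IsSuccinctReduction c L cl) (hq : q ≠ 0)
    {P₁ P₃ A MF MS : TM2ComputableAux Bool Bool}
    (hP₁ : ReassocMachine P₁ C₁) (hP₃ : OkDispatchMachine P₃ C₃)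
    {ok : List Bool → List Bool → Bool} {out : List Bool → List Bool → List Bool}
    (hA : ∀ x y, A.OutputsWithin (boolPair x y) (ok x y :: out x y)
      (cA * (williamsBound x.length + y.length) + cA))
    (hsound : ∀ x y, ok x y = true → GoodClauseCircuits c cl m dG eG x (out x y))
    {F : List Bool → List Bool} {pF : Polynomial ℕ}
    (hMF : ∀ a, MF.OutputsWithin a (F a) (pF.eval a.length))
    (hF : SatInstanceFn.SpecQ m (dW + 3) q W₀ F)
    (hMS : ∀ (n : ℕ) (C : Circuit (Fin n)), C.IsOver (accBasis m) → C.acDepth ≤ dW + 3 + dG + 4 →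
      C.size ≤ 2 ^ Nat.nthRoot r n → C.maxFanIn ≤ 2 ^ Nat.nthRoot r n →
        MS.OutputsWithin (encodeAccCircuit m C) (encodeBool (decide C.Satisfiable))
          (cS * 2 ^ (n - Nat.nthRoot r n) + cS))
    (Y : ℕ → ℕ)
    (hclass : ∀ n, W₀ ≤ succinctWidth c n →
      3 * (succinctWidth c n + 2) * (succinctWidth c n ^ eG + eG) +
          3 * 2 ^ Nat.nthRoot q (succinctWidth c n) + 20 ≤ 2 ^ Nat.nthRoot r (succinctWidth c n) ∧
        succinctWidth c n ^ eG + eG + Y n + 3 ≤ 2 ^ Nat.nthRoot r (succinctWidth c n))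
    (x z : List Bool) :
    (P₁.comp ((mapFstAux A).comp (P₃.comp (MF.comp (complMachine (flagAux MS fun _ => [true])))))).OutputsWithin
      (boolPair (boolPair x (ones (Y x.length))) z)
      [acceptQ F ok out m c (dW + 3) q W₀ Y x z]
      (coreTimeQ C₁ C₃ cA (machinePushBound A.tm) cS c eG r pF Y x.length z.length) := by
  -- names
  set yA := (boolUnpair z).1 with hyA
  set g := guardLen (Y x.length) (boolUnpair z).2 with hg
  set v := ok x yA :: out x yA with hv
  have hzparts := length_boolUnpair_parts_le z
  have hyAZ : yA.length ≤ z.length := by rw [hyA]; omega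
  have hgq : g.length ≤ Y x.length := length_guardLen_le _ _
  have hgZ : g.length ≤ z.length := (length_guardLen_le_self _ _).trans (by omega)
  have hnw : x.length ≤ succinctWidth c x.length := le_succinctWidth c x.length
  have hpow : x.length ^ eG ≤ succinctWidth c x.length ^ eG := Nat.pow_le_pow_left hnw _
  -- stage 1
  have h1 : P₁.OutputsWithin (boolPair (boolPair x (ones (Y x.length))) z) (boolPair (boolPair x yA) g)
      (C₁ * (boolPair (boolPair x (ones (Y x.length))) z).length + C₁) := by
    have := hP₁ x (ones (Y x.length)) z
    simpa [List.length_replicate, ← hyA, ← hg] using this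
  -- stage 2: the generator behind `mapFstAux`
  have hAv : A.OutputsWithin (boolUnpair (boolPair (boolPair x yA) g)).1 v
      (cA * (williamsBound x.length + yA.length) + cA) := by
    rw [boolUnpair_boolPair]; exact hA x yA
  have h2 := outputsWithin_mapFstAux A hAv
  rw [readRest_boolPair] at h2
  have hvlen : v.length ≤ 2 * x.length + 2 + yA.length +
      machinePushBound A.tm * (cA * (williamsBound x.length + yA.length) + cA) := by
    have := length_le_of_outputsWithin A (hA x yA)
    simp only [hv, List.length_cons, length_boolPair] at this ⊢
    omega
  -- stage 3
  have h3 := hP₃ v g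
  -- stage F
  have h4 := hMF (okToken v g)
  -- stage SAT (+ flag, complement): output `[acceptQ]` within `cS T(w) + cS + 3`
  have h5 : (complMachine (flagAux MS fun _ => [true])).OutputsWithin (F (okToken v g))
      [acceptQ F ok out m c (dW + 3) q W₀ Y x z]
      (cS * 2 ^ (succinctWidth c x.length - Nat.nthRoot r (succinctWidth c x.length)) + cS + 3) ∧
      (okToken v g).length ≤ fInLenB c eG x.length (Y x.length) := by
    by_cases hok : ok x yA = true
    · obtain ⟨G, hG, hout⟩ := hsound x yA hok
      have hGo : ∀ κ, (G κ).IsOver (accBasis m) := fun κ => (hG κ).1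
      have hGs : ∀ κ, (G κ).size ≤ succinctWidth c x.length ^ eG + eG :=
        fun κ => (hG κ).2.2.1.trans (by omega)
      have hvt : v = true :: out x yA := by rw [hv, hok]
      have htok : okToken v g = true :: boolPair (out x yA) g := by rw [hvt]; rfl
      have hlen : (okToken v g).length ≤ fInLenB c eG x.length (Y x.length) := by
        rw [htok, List.length_cons, length_boolPair]
        have := length_out_le (hsound x yA hok)
        unfold fInLenB; omega
      refine ⟨?_, hlen⟩
      have hGf : ∀ κ, (G κ).maxFanIn ≤ succinctWidth c x.length ^ eG + eG :=
        fun κ => (hG κ).2.2.2.1.trans (by omega)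
      rcases (hF.2 (succinctWidth c x.length) G hGo).1 g with hzero | ⟨W, hWB, hWd, hWadm, hWf, hFW⟩
      · -- `F` rejects: answer `[true]`, complemented `[false]`; `acceptQ = false`
        have hacc : acceptQ F ok out m c (dW + 3) q W₀ Y x z = false := by
          rw [← Bool.not_eq_true, acceptQ_eq_true_iff]
          rintro ⟨G', W', -, hG'o, hout', -, -, -, hF', -⟩
          have hGG : G' = G := clauseCircuits_eq_of_encode_eq hG'o hGo (hout'.symm.trans hout)
          subst hGG
          rw [← hyA, ← hg, hout, hzero] at hF'
          exact absurd hF' (by simp)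
        rw [hacc, htok, hout, hzero]
        have := flagAux_outputsWithin_answer MS (fun _ => [true]) false
        exact (complMachine_outputsWithin this).mono (by omega)
      · -- `F` prints the instance `D = circuit G W`; `W` admissible, so `w ≥ W₀`, `|W| < 2^{⌊w^{1/q}⌋}`
        have hW₀ : W₀ ≤ succinctWidth c x.length := (admQ_eq_true_iff.1 hWadm).1
        have hWs : W.size < 2 ^ Nat.nthRoot q (succinctWidth c x.length) :=
          lt_two_pow_nthRoot_of_admQ hq hWadm
        have hspec := circuit_spec hred x G hGo (fun κ => (hG κ).2.1) hGs hGf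
          (fun κ => (hG κ).2.2.2.2) W hWB hWd hWs.le
        obtain ⟨hDo, hDd, hDs, hDf, -, -⟩ := hspec
        obtain ⟨hcl1, hcl2⟩ := hclass x.length hW₀
        have hDs' : (circuit G W).size ≤ 2 ^ Nat.nthRoot r (succinctWidth c x.length) :=
          hDs.trans hcl1
        have hDf' : (circuit G W).maxFanIn ≤ 2 ^ Nat.nthRoot r (succinctWidth c x.length) := by
          refine hDf.trans (le_trans ?_ hcl2)
          have : W.maxFanIn ≤ Y x.length := hWf.trans hgq
          omega
        have hS := hMS (succinctWidth c x.length) (circuit G W) hDo (by omega) hDs' hDf'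
        have hrun := flagAux_outputsWithin_run MS (fun _ => [true]) hS
        have hcompl := complMachine_outputsWithin hrun
        -- the value of `acceptQ`
        have hacc : acceptQ F ok out m c (dW + 3) q W₀ Y x z = !decide (circuit G W).Satisfiable := by
          by_cases hsat : (circuit G W).Satisfiable
          · rw [decide_eq_true hsat, Bool.not_true, ← Bool.not_eq_true, acceptQ_eq_true_iff]
            rintro ⟨G', W', -, hG'o, hout', hW'B, -, -, hF', hunsat'⟩
            have hGG : G' = G := clauseCircuits_eq_of_encode_eq hG'o hGo (hout'.symm.trans hout)
            subst hGG
            rw [← hyA, ← hg, hout, hFW] at hF'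
            simp only [List.cons.injEq, true_and] at hF'
            have hD'o : (circuit G' W').IsOver (accBasis m) :=
              circuit_isOver G' W' (acBasis_subset_accBasis m) hGo hW'B
            have hDD : circuit G' W = circuit G' W' := encodeAccCircuit_injOn m _ hDo hD'o hF'
            exact hunsat' (hDD ▸ hsat)
          · rw [decide_eq_false hsat, Bool.not_false, acceptQ_eq_true_iff]
            refine ⟨G, W, hok, hGo, hout, hWB, hWd, hWadm, ?_, hsat⟩
            rw [← hyA, ← hg, hout, hFW]
        rw [hacc, htok, hout, hFW]
        exact hcompl.mono (by omega)
    · -- the generator rejects: token `00`, `F 00 = 00`, answer `[true]`, complemented `[false]`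
      have hokf : ok x yA = false := by simpa using hok
      have hvf : v = false :: out x yA := by rw [hv, hokf]
      have htok : okToken v g = [false, false] := by rw [hvf]; rfl
      have hacc : acceptQ F ok out m c (dW + 3) q W₀ Y x z = false := by
        rw [← Bool.not_eq_true, acceptQ_eq_true_iff]
        rintro ⟨-, -, hok', -⟩
        rw [← hyA] at hok'
        exact hok hok'
      refine ⟨?_, by rw [htok]; unfold fInLenB; simp only [List.length_cons, List.length_nil]; omega⟩
      rw [hacc, htok, hF.1]
      have := flagAux_outputsWithin_answer MS (fun _ => [true]) false
      exact (complMachine_outputsWithin this).mono (by omega)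
  obtain ⟨h5, hlen3⟩ := h5
  -- compose
  have h45 := TM2ComputableAux.comp_outputsWithin _ _ h4 h5
  have h345 := TM2ComputableAux.comp_outputsWithin _ _ h3 h45
  have h2345 := TM2ComputableAux.comp_outputsWithin _ _ h2 h345
  have hall := TM2ComputableAux.comp_outputsWithin _ _ h1 h2345
  refine hall.mono ?_
  -- arithmetic
  have hpF : pF.eval (okToken v g).length ≤ pF.eval (fInLenB c eG x.length (Y x.length)) :=
    natPoly_eval_mono pF hlen3
  have hl1 : (boolPair (boolPair x (ones (Y x.length))) z).length =
      4 * x.length + 6 + 2 * Y x.length + z.length := by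
    simp only [length_boolPair, List.length_replicate]; ring
  have hl2 : (boolPair (boolPair x yA) g).length ≤ 4 * x.length + 6 + 2 * z.length + Y x.length := by
    simp only [length_boolPair]; omega
  have htA' : cA * (williamsBound x.length + yA.length) + cA ≤
      cA * (williamsBound x.length + z.length) + cA := by gcongr
  have hmul := Nat.mul_le_mul_left (machinePushBound A.tm) htA'
  have hv' : v.length ≤ 2 * x.length + 2 + z.length +
      machinePushBound A.tm * (cA * (williamsBound x.length + z.length) + cA) := by omega
  have hl3 : (boolPair v g).length ≤
      2 * (2 * x.length + 2 + z.length +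
        machinePushBound A.tm * (cA * (williamsBound x.length + z.length) + cA)) + 2 + Y x.length := by
    rw [length_boolPair]; omega
  have e3 := Nat.mul_le_mul_left C₃ hl3
  unfold coreTimeQ
  rw [hl1] at hall ⊢
  omega

/-- **The core machine of the subexponential `B` runs in time `O(williamsBound n)`** on certificates
of length `O(williamsBound n)`, given that the yardstick, stage `F` at the yardstick and the SAT call
are `O(williamsBound n)` (cf. `coreTime_le`). [folklore] -/
theorem coreTimeQ_le (C₁ C₃ cA DA cS c eG r : ℕ) (pF : Polynomial ℕ) (Y : ℕ → ℕ) (cq cF cz KS : ℕ)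
    (hq : ∀ n, Y n ≤ cq * williamsBound n + cq)
    (hpF : ∀ n, pF.eval (fInLenB c eG n (Y n)) ≤ cF * williamsBound n + cF)
    (hKS : ∀ n, 2 ^ (succinctWidth c n - Nat.nthRoot r (succinctWidth c n)) ≤ KS * williamsBound n + KS) :
    ∃ K, ∀ n Z, Z ≤ cz * williamsBound n + cz →
      coreTimeQ C₁ C₃ cA DA cS c eG r pF Y n Z ≤ K * williamsBound n + K := by
  refine ⟨C₁ * (4 * 1 + 6 + 2 * cq + cz) + C₁ +
      (cA * (1 + cz) + cA + 3 * (2 * 1 + 2 + cz + DA * (cA * (1 + cz) + cA)) +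
        2 * (4 * 1 + 6 + 2 * cz + cq) + 6) +
      (C₃ * (2 * (2 * 1 + 2 + cz + DA * (cA * (1 + cz) + cA)) + 2 + cq) + C₃) + cF +
      (cS * KS + cS + 3), fun n Z hZ => ?_⟩
  have hT : LeAff (williamsBound n) 1 (williamsBound n) := LeAff.self _
  have hn : LeAff n 1 (williamsBound n) := hT.of_le (le_williamsBound n)
  have hqn : LeAff (Y n) cq (williamsBound n) := hq n
  have hZ' : LeAff Z cz (williamsBound n) := hZ
  have hF' : LeAff (pF.eval (fInLenB c eG n (Y n))) cF (williamsBound n) := hpF n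
  have hS : LeAff (cS * 2 ^ (succinctWidth c n - Nat.nthRoot r (succinctWidth c n)) + cS + 3)
      (cS * KS + cS + 3) (williamsBound n) := by
    have := hKS n
    have := Nat.mul_le_mul_left cS this
    unfold LeAff; nlinarith [this]
  -- stage 1
  have i1 : LeAff (4 * n + 6 + 2 * Y n + Z) (4 * 1 + 6 + 2 * cq + cz) (williamsBound n) :=
    (((hn.mul 4).add (LeAff.const 6 _)).add (hqn.mul 2)).add hZ'
  have t1 := i1.affine C₁
  -- stage 2
  have tA : LeAff (cA * (williamsBound n + Z) + cA) (cA * (1 + cz) + cA) (williamsBound n) :=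
    (hT.add hZ').affine cA
  have vB : LeAff (2 * n + 2 + Z + DA * (cA * (williamsBound n + Z) + cA))
      (2 * 1 + 2 + cz + DA * (cA * (1 + cz) + cA)) (williamsBound n) :=
    (((hn.mul 2).add (LeAff.const 2 _)).add hZ').add (tA.mul DA)
  have i2 : LeAff (4 * n + 6 + 2 * Z + Y n) (4 * 1 + 6 + 2 * cz + cq) (williamsBound n) :=
    (((hn.mul 4).add (LeAff.const 6 _)).add (hZ'.mul 2)).add hqn
  have t2 := ((tA.add (vB.mul 3)).add (i2.mul 2)).add (LeAff.const 6 (williamsBound n))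
  -- stage 3
  have i3 := ((vB.mul 2).add (LeAff.const 2 (williamsBound n))).add hqn
  have t3 := i3.affine C₃
  -- all
  have := (((t1.add t2).add t3).add hF').add hS
  exact this.le

end MachineB


/-! ### The thresholds: the class of the SAT instances and the completeness of long inputs -/

/-- **The class threshold**: for roots `r < r₁`, `r < q` (`r ≠ 0`) there is `W₀` such that for all
widths `w ≥ W₀` the witness-check circuit of an admissible `W` (`|W| < 2^{⌊w^{1/q}⌋}`, clause circuits
of `w^{e_G} + e_G` gates, fan-in at most the yardstick `2^{⌊w^{1/r₁}⌋} + 2`) has at most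
`2^{⌊w^{1/r}⌋}` gates and fan-in — the class of `AccSatSubexp · m r` (Murray–Williams 2018, proof of
Thm. 1.2: "the size of `D` is `2^{O(log^{k⁴} n)} ≤ 2^{log^ε t(n)} … ≤ 2^{ℓ^ε}, so the assumed …
algorithm can be run on `D`"). [cite: MurrayWilliams2018, Thm. 1.2 (proof, §5)] -/
theorem exists_classThreshold (eG q r₁ r : ℕ) (hr : r ≠ 0) (hr₁ : r < r₁) (hrq : r < q) :
    ∃ W₀ : ℕ, ∀ w : ℕ, W₀ ≤ w →
      3 * (w + 2) * (w ^ eG + eG) + 3 * 2 ^ Nat.nthRoot q w + 20 ≤ 2 ^ Nat.nthRoot r w ∧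
        w ^ eG + eG + (2 ^ Nat.nthRoot r₁ w + 2) + 3 ≤ 2 ^ Nat.nthRoot r w := by
  obtain ⟨N₁, hN₁⟩ := eventually_poly_mul_two_pow_le_two_pow_nthRoot
    (C 3 * (X + C 2) * (X ^ eG + C eG) + C 23) hr hrq 1
  obtain ⟨N₂, hN₂⟩ := eventually_poly_mul_two_pow_le_two_pow_nthRoot (X ^ eG + C (eG + 5)) hr hr₁ 1
  refine ⟨max N₁ N₂, fun w hw => ⟨?_, ?_⟩⟩
  · have h := hN₁ w (le_of_max_le_left hw)
    simp only [eval_add, eval_mul, eval_C, eval_X, eval_pow] at h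
    set P := 3 * (w + 2) * (w ^ eG + eG) with hP
    set T := 2 ^ Nat.nthRoot q w with hT
    have h1 : 1 ≤ T := Nat.one_le_two_pow
    have hPT : P ≤ P * T := Nat.le_mul_of_pos_right _ h1
    have h2 : 2 ^ (1 * Nat.nthRoot q w + 1) = 2 * T := by rw [one_mul, pow_succ, hT]; ring
    rw [h2] at h
    have hexp : (P + 23) * (2 * T) = 2 * (P * T) + 46 * T := by ring
    rw [hexp] at h
    omega
  · have h := hN₂ w (le_of_max_le_right hw)
    simp only [eval_add, eval_C, eval_X, eval_pow] at h
    set P := w ^ eG with hP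
    set T := 2 ^ Nat.nthRoot r₁ w with hT
    have h1 : 1 ≤ T := Nat.one_le_two_pow
    have hPT : P ≤ P * T := Nat.le_mul_of_pos_right _ h1
    have heT : eG ≤ eG * T := Nat.le_mul_of_pos_right _ h1
    have h2 : 2 ^ (1 * Nat.nthRoot r₁ w + 1) = 2 * T := by rw [one_mul, pow_succ, hT]; ring
    rw [h2] at h
    have hexp : (P + (eG + 5)) * (2 * T) = 2 * (P * T) + 2 * (eG * T) + 10 * T := by ring
    rw [hexp] at h
    omega

/-- **The completeness threshold**: with `r₂ = 2 (r₁ + 1)` and `q' = r₂ + 1` (`r₁ ≠ 0`), for every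
`W₀`, `a`, `c`, `m` there is `N₁` such that for all `n ≥ N₁`, at width `w = succinctWidth c n`: the
threshold `W₀` is passed; a witness of `a · 2^{⌊n^{1/q'}⌋} + a` gates padded to `w` inputs has fewer
than `2^{⌊w^{1/r₂}⌋}` gates; and the code of any circuit with fewer than `2^{⌊w^{1/r₂}⌋}` gates and
normalised fan-in fits the yardstick `2^{⌊n^{1/r₁}⌋} + 2` (`codeLen_le_cube`; `w ≤ n²` and
`⌊(n²)^{1/r₂}⌋ ≤ ⌊n^{1/(r₁+1)}⌋`, `nthRoot_mul_pow_le`). [folklore] -/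
theorem exists_completeThreshold (c m a W₀ : ℕ) {r₁ : ℕ} (hr₁ : r₁ ≠ 0) :
    ∃ N₁ : ℕ, ∀ n : ℕ, N₁ ≤ n → W₀ ≤ succinctWidth c n ∧
      a * 2 ^ Nat.nthRoot (2 * (r₁ + 1) + 1) n + a + succinctWidth c n + 2 <
        2 ^ Nat.nthRoot (2 * (r₁ + 1)) (succinctWidth c n) ∧
      MachineB.codeLen (succinctWidth c n) (2 ^ Nat.nthRoot (2 * (r₁ + 1)) (succinctWidth c n))
        (m * (succinctWidth c n + 2 ^ Nat.nthRoot (2 * (r₁ + 1)) (succinctWidth c n))) ≤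
          2 ^ Nat.nthRoot r₁ n + 2 := by
  obtain ⟨N, hN⟩ := eventually_poly_mul_two_pow_le_two_pow_nthRoot (C (c + 1) * X + C (2 * a + c + 2))
    (r := 2 * (r₁ + 1)) (r₂ := 2 * (r₁ + 1) + 1) (by omega) (by omega) 1
  obtain ⟨N', hN'⟩ := eventually_poly_mul_two_pow_le_two_pow_nthRoot
    (C 7 * (C (m + 1) * X ^ 2 + C (m + 8)) ^ 3) (r := r₁) (r₂ := r₁ + 1) hr₁ (by omega) 3
  refine ⟨max (max W₀ (c + 2)) (max N N'), fun n hn => ?_⟩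
  have hW₀n : W₀ ≤ n := le_trans (le_max_left _ _) (le_of_max_le_left hn)
  have hcn : c + 2 ≤ n := le_trans (le_max_right _ _) (le_of_max_le_left hn)
  have hNn : N ≤ n := le_trans (le_max_left _ _) (le_of_max_le_right hn)
  have hN'n : N' ≤ n := le_trans (le_max_right _ _) (le_of_max_le_right hn)
  have hw : n ≤ succinctWidth c n := le_succinctWidth c n
  have hwle : succinctWidth c n ≤ (c + 1) * n + c := succinctWidth_le c n
  refine ⟨hW₀n.trans hw, ?_, ?_⟩
  · -- the padded witness is below `2^{⌊w^{1/r₂}⌋}`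
    have h := hN n hNn
    simp only [eval_add, eval_mul, eval_C, eval_X] at h
    set ρ' := Nat.nthRoot (2 * (r₁ + 1) + 1) n with hρ'
    have h1 : 1 ≤ 2 ^ ρ' := Nat.one_le_two_pow
    have h2 : 2 ^ (1 * ρ' + 1) = 2 * 2 ^ ρ' := by rw [one_mul, pow_succ]; ring
    rw [h2] at h
    have hmono : 2 ^ Nat.nthRoot (2 * (r₁ + 1)) n ≤ 2 ^ Nat.nthRoot (2 * (r₁ + 1)) (succinctWidth c n) :=
      Nat.pow_le_pow_right two_pos (PolyExistsNTIME.nthRoot_mono_right (by omega) hw)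
    nlinarith
  · -- the code of an admissible normalised witness fits the yardstick
    have h := hN' n hN'n
    simp only [eval_mul, eval_C, eval_pow, eval_add, eval_X] at h
    set t := Nat.nthRoot (r₁ + 1) n with ht
    have hsq : succinctWidth c n ≤ n ^ 2 := succinctWidth_le_sq hcn
    have hroot : Nat.nthRoot (2 * (r₁ + 1)) (succinctWidth c n) ≤ t :=
      (PolyExistsNTIME.nthRoot_mono_right (by omega) hsq).trans
        (PolyExistsNTIME.nthRoot_mul_pow_le two_ne_zero (by omega) n)
    have hTle : 2 ^ Nat.nthRoot (2 * (r₁ + 1)) (succinctWidth c n) ≤ 2 ^ t :=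
      Nat.pow_le_pow_right two_pos hroot
    set T := 2 ^ t with hT
    have hT1 : 1 ≤ T := Nat.one_le_two_pow
    have hc1 := MachineB.codeLen_mono hsq hTle (Nat.mul_le_mul_left m (Nat.add_le_add hsq hTle))
    have hc2 := codeLen_le_cube (n ^ 2) T (m * (n ^ 2 + T))
    have hX : n ^ 2 + T + m * (n ^ 2 + T) + 7 ≤ ((m + 1) * n ^ 2 + (m + 8)) * T := by
      have e1 : n ^ 2 ≤ n ^ 2 * T := Nat.le_mul_of_pos_right _ hT1
      have e2 : m * n ^ 2 ≤ m * n ^ 2 * T := Nat.le_mul_of_pos_right _ hT1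
      have hexp : ((m + 1) * n ^ 2 + (m + 8)) * T = m * n ^ 2 * T + n ^ 2 * T + m * T + 8 * T := by ring
      have hexp2 : m * (n ^ 2 + T) = m * n ^ 2 + m * T := by ring
      rw [hexp, hexp2]; omega
    have hc3 : 7 * (n ^ 2 + T + m * (n ^ 2 + T) + 7) ^ 3 ≤ 7 * (((m + 1) * n ^ 2 + (m + 8)) * T) ^ 3 :=
      Nat.mul_le_mul_left 7 (Nat.pow_le_pow_left hX 3)
    have hc4 : 7 * (((m + 1) * n ^ 2 + (m + 8)) * T) ^ 3 =
        7 * ((m + 1) * n ^ 2 + (m + 8)) ^ 3 * 2 ^ (3 * t) := by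
      rw [mul_pow, hT, ← pow_mul, mul_comm t 3]; ring
    have hc5 : 7 * ((m + 1) * n ^ 2 + (m + 8)) ^ 3 * 2 ^ (3 * t) ≤
        7 * ((m + 1) * n ^ 2 + (m + 8)) ^ 3 * 2 ^ (3 * t + 3) :=
      Nat.mul_le_mul_left _ (Nat.pow_le_pow_right two_pos (Nat.le_add_right _ _))
    calc MachineB.codeLen (succinctWidth c n) (2 ^ Nat.nthRoot (2 * (r₁ + 1)) (succinctWidth c n))
          (m * (succinctWidth c n + 2 ^ Nat.nthRoot (2 * (r₁ + 1)) (succinctWidth c n)))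
        ≤ MachineB.codeLen (n ^ 2) T (m * (n ^ 2 + T)) := hc1
      _ ≤ 7 * (n ^ 2 + T + m * (n ^ 2 + T) + 7) ^ 3 := hc2
      _ ≤ 7 * (((m + 1) * n ^ 2 + (m + 8)) * T) ^ 3 := hc3
      _ = 7 * ((m + 1) * n ^ 2 + (m + 8)) ^ 3 * 2 ^ (3 * t) := hc4
      _ ≤ 7 * ((m + 1) * n ^ 2 + (m + 8)) ^ 3 * 2 ^ (3 * t + 3) := hc5
      _ ≤ 2 ^ Nat.nthRoot r₁ n := h
      _ ≤ 2 ^ Nat.nthRoot r₁ n + 2 := Nat.le_add_right _ _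

/-! ### The machine `B` at subexponential witness size -/

open MachineB WitnessCheck TM2Comp in
/-- **Murray–Williams 2018, §5 / Williams 2014, proof of Thm. 3.2: the machine `B` run with
SUBEXPONENTIAL witness circuits** — the hypothesis `hB` of
`MurrayWilliams2018_NQP_not_subset_ACC0_of_lemma_4_1_ae_of_machineB` (`MurrayWilliams2018Headline.lean`).
Given a succinct reduction `cl` (constant `c`) of `L`, a modulus `m ≥ 2`, generated clause circuits
(`NGenerates williamsBound (GoodClauseCircuits c cl m dG eG)`, Williams' Lemma 3.1) and `AC⁰[m]`-SAT
algorithms for `2^{⌊w^{1/r}⌋}`-size circuits in time `O(2^{w - ⌊w^{1/r}⌋})` at every depth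
(`AccSatSubexp`, Murray–Williams' Thm. 5.1), `B` names the root `q = 2 (r + 2) + 1` (`r` the root of
the algorithm at the depth `d_W + d_G + 7` of its instances) such that, if every `x ∈ L` has a
satisfying assignment of `succinctCNF c cl x` encoded by an `accBasis m`-circuit of depth `≤ dW`,
`≤ succinctWidth c |x|` inputs and `≤ a · 2^{⌊|x|^{1/q}⌋} + a` gates, then `L ∈ NTIME(n + 2ⁿ/n)`: the
verifier `truncMapAux (clock ▸ mapFstAux rootClock) ▸ P₁ ▸ mapFstAux A ▸ P₃ ▸ M_F ▸ compl (flagAux M_SAT)`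
(`mem_NTIME_of_prefixMachine_pre`, `core_outputsWithinQ`, `coreTimeQ_le`) decides `L` on all inputs
of length `≥ N₁` (`mem_of_acceptQ`, `acceptQ_of_mem`), and the finitely many short inputs are patched
(`mem_NTIME_of_eqOn`, `isTimeConstructible_williamsBound`). Murray–Williams, proof of Thm. 1.2: "On an
input `1ⁿ`, let `N` be a nondeterministic algorithm which … guesses a witness circuit `Wₙ` of size
`2^{O(log^{k³} n)}` … the assumed nondeterministic GAP `C` UNSAT algorithm can be run on `D` …
obtaining yes/no answers in nondeterministic time `O(2^{ℓ−ℓ^ε})`".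
[cite: MurrayWilliams2018, Thm. 1.2 (proof, §5); Williams2014, proof of Thm. 3.2 (pp. 12–13)] -/
theorem MurrayWilliams2018_machineB_subexp :
    ∀ (c : ℕ) (L : Language Bool) (cl : List Bool → ℕ → Clause ℕ) (m dG eG dW : ℕ),
      IsSuccinctReduction c L cl → 2 ≤ m →
      NGenerates williamsBound (GoodClauseCircuits c cl m dG eG) →
      (∀ d' : ℕ, ∃ r : ℕ, 2 ≤ r ∧ AccSatSubexp d' m r) →
      ∃ q : ℕ, 1 ≤ q ∧
        ((∃ a : ℕ, ∀ x ∈ L, ∃ (k : ℕ) (W : Circuit (Fin k)), k ≤ succinctWidth c x.length ∧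
            W.IsOver (accBasis m) ∧ W.acDepth ≤ dW ∧
            W.size ≤ a * 2 ^ Nat.nthRoot q x.length + a ∧
            (succinctCNF c cl x).eval W.assignment = true) →
          L ∈ NTIME williamsBound) := by
  intro c L cl m dG eG dW hred hm hgen hsat
  obtain ⟨r, hr2, hS⟩ := hsat (dW + 3 + dG + 4)
  refine ⟨2 * (r + 1 + 1) + 1, by omega, ?_⟩
  rintro ⟨a, hWit⟩
  have hm0 : 0 < m := by omega
  have hr0 : r ≠ 0 := by omega
  obtain ⟨cA, ok, out, A, hA, hsound, hcompl⟩ := hgen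
  obtain ⟨cS, MS, hMS⟩ := (accSatSubexp_iff _ _ _).1 hS
  obtain ⟨P₁, C₁, hP₁⟩ := exists_reassocMachine'
  obtain ⟨P₃, C₃, hP₃⟩ := exists_okDispatchMachine'
  -- the thresholds, stage `F`, the yardstick `Y n = 2^{⌊n^{1/(r+1)}⌋} + 2` and its clock
  obtain ⟨W₀, hW₀⟩ := exists_classThreshold eG (2 * (r + 1 + 1)) (r + 1) r hr0 (by omega) (by omega)
  obtain ⟨F, ⟨pF, MF, hMF⟩, hFspec⟩ := SatCode.exists_satInstanceFnQ m (dW + 3) (2 * (r + 1 + 1)) W₀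
  obtain ⟨N₁, hN₁⟩ := exists_completeThreshold c m a W₀ (r₁ := r + 1) (by omega)
  obtain ⟨PC, KC, RC, hRC⟩ := exists_rootClock_machine (r' := r + 1) (by omega) 1
  set Y : ℕ → ℕ := rootClockLen (r + 1) 1 with hY
  have hYeq : ∀ n, Y n = 2 ^ Nat.nthRoot (r + 1) n + 2 := fun n => by
    simp only [hY, rootClockLen]; ring
  -- every cost is `O(williamsBound n)`
  obtain ⟨K₂, hK₂⟩ := exists_two_pow_nthRoot_le_williamsBound (r := r + 1) (by omega) 1
  have h2ρ : ∀ n, 2 ^ Nat.nthRoot (r + 1) n ≤ K₂ * williamsBound n + K₂ := fun n =>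
    (Nat.pow_le_pow_right two_pos (by omega)).trans (hK₂ n)
  obtain ⟨cq, hcq⟩ : ∃ cq, ∀ n, Y n ≤ cq * williamsBound n + cq :=
    ⟨K₂ + 2, fun n => by rw [hYeq]; have := h2ρ n; nlinarith⟩
  obtain ⟨cF, hcF⟩ : ∃ cF, ∀ n, pF.eval (fInLenB c eG n (Y n)) ≤ cF * williamsBound n + cF := by
    obtain ⟨Ac, e, hpF⟩ := exists_eval_le_mul_pow_add pF
    obtain ⟨KQ, hKQ⟩ := exists_poly_mul_two_pow_nthRoot_le_williamsBound
      (C Ac * (C 5 + C 2 * outPoly c eG + 1) ^ e) (r₁ := r + 1) (by omega) e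
    refine ⟨KQ + Ac, fun n => ?_⟩
    have hin : fInLenB c eG n (Y n) ≤ (5 + 2 * (outPoly c eG).eval n) + 2 ^ Nat.nthRoot (r + 1) n := by
      have := outLenB_le_outPoly c eG n
      rw [hYeq]; unfold fInLenB; omega
    set ρ := Nat.nthRoot (r + 1) n with hρ
    set Pn := 5 + 2 * (outPoly c eG).eval n with hPn
    have h1 : Pn + 2 ^ ρ ≤ (Pn + 1) * 2 ^ ρ := by nlinarith [Nat.one_le_two_pow (n := ρ)]
    have h2 : (Pn + 2 ^ ρ) ^ e ≤ (Pn + 1) ^ e * 2 ^ (e * ρ) := by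
      rw [pow_mul', ← mul_pow]; exact Nat.pow_le_pow_left h1 e
    have h3 := hKQ n
    simp only [eval_mul, eval_C, eval_pow, eval_add, eval_one] at h3
    have h4 : 2 ^ (e * ρ) ≤ 2 ^ (e * ρ + e) := Nat.pow_le_pow_right two_pos (Nat.le_add_right _ _)
    calc pF.eval (fInLenB c eG n (Y n)) ≤ pF.eval (Pn + 2 ^ ρ) := natPoly_eval_mono pF hin
      _ ≤ Ac * (Pn + 2 ^ ρ) ^ e + Ac := hpF _
      _ ≤ Ac * ((Pn + 1) ^ e * 2 ^ (e * ρ + e)) + Ac := by gcongr; exact h2.trans (Nat.mul_le_mul_left _ h4)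
      _ = Ac * (5 + 2 * (outPoly c eG).eval n + 1) ^ e * 2 ^ (e * ρ + e) + Ac := by rw [hPn]; ring
      _ ≤ KQ * williamsBound n + KQ + Ac := Nat.add_le_add_right h3 _
      _ ≤ (KQ + Ac) * williamsBound n + (KQ + Ac) := by nlinarith
  obtain ⟨KS, hKS⟩ := exists_satTimeSubexp_le c hr0
  obtain ⟨cP, hcP⟩ : ∃ cP, ∀ n, PC.eval n + KC * 2 ^ Nat.nthRoot (r + 1) n ≤ cP * williamsBound n + cP := by
    obtain ⟨c₁, hc₁⟩ := exists_poly_le_id_add_two_pow_div PC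
    refine ⟨c₁ + KC * K₂, fun n => ?_⟩
    have h1 : PC.eval n ≤ c₁ * williamsBound n + c₁ := hc₁ n
    have h2 := Nat.mul_le_mul_left KC (h2ρ n)
    nlinarith
  -- the certificate length and its clock
  have hTC : IsTimeConstructible fun n => (2 * cA + cq + 2) * williamsBound n + (2 * cA + cq + 2) :=
    isTimeConstructible_williamsBound.mul_add (by omega)
  obtain ⟨N, aN, hN⟩ := exists_unaryClock_of_timeConstructible hTC
  -- the core time
  obtain ⟨K, hK⟩ := coreTimeQ_le C₁ C₃ cA (machinePushBound A.tm) cS c eG r pF Y cq cF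
    (2 * cA + cq + 2) KS hcq hcF hKS
  -- the total time is `O(williamsBound n)`
  obtain ⟨cB, hcB⟩ : ∃ cB, ∀ n,
      (cP * williamsBound n + cP + 3 * (2 * n + 2 + Y n) +
          2 * (2 * n + 2 + ((2 * cA + cq + 2) * williamsBound n + (2 * cA + cq + 2))) + 6) +
        (aN * ((2 * cA + cq + 2) * williamsBound n + (2 * cA + cq + 2)) + aN) +
        (K * williamsBound n + K) +
        ((2 * cA + cq + 2) * williamsBound n + (2 * cA + cq + 2)) +
        (2 * n + 2 + Y n) + n ≤ cB * williamsBound n + cB := by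
    refine ⟨cP + 3 * (2 * 1 + 2 + cq) + 2 * (2 * 1 + 2 + (2 * cA + cq + 2)) + 6 +
      (aN * (2 * cA + cq + 2) + aN) + K + (2 * cA + cq + 2) + (2 * 1 + 2 + cq) + 1, fun n => ?_⟩
    have hn : LeAff n 1 (williamsBound n) := (LeAff.self _).of_le (le_williamsBound n)
    have hq : LeAff (Y n) cq (williamsBound n) := hcq n
    have hP : LeAff (cP * williamsBound n + cP) cP (williamsBound n) := le_refl _
    have hsx : LeAff ((2 * cA + cq + 2) * williamsBound n + (2 * cA + cq + 2)) (2 * cA + cq + 2)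
        (williamsBound n) := le_refl _
    have hK' : LeAff (K * williamsBound n + K) K (williamsBound n) := le_refl _
    have l1 : LeAff (2 * n + 2 + Y n) (2 * 1 + 2 + cq) (williamsBound n) :=
      ((hn.mul 2).add (LeAff.const 2 _)).add hq
    have l2 : LeAff (2 * n + 2 + ((2 * cA + cq + 2) * williamsBound n + (2 * cA + cq + 2)))
        (2 * 1 + 2 + (2 * cA + cq + 2)) (williamsBound n) :=
      ((hn.mul 2).add (LeAff.const 2 _)).add hsx
    have t1a := ((hP.add (l1.mul 3)).add (l2.mul 2)).add (LeAff.const 6 (williamsBound n))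
    have t1b := hsx.affine aN
    exact (((((t1a.add t1b).add hK').add hsx).add l1).add hn).le
  -- the language decided by the machine is in `NTIME williamsBound`
  set L' : Language Bool := {x | ∃ z : List Bool,
      z.length ≤ (2 * cA + cq + 2) * williamsBound x.length + (2 * cA + cq + 2) ∧
        acceptQ F ok out m c (dW + 3) (2 * (r + 1 + 1)) W₀ Y x z = true} with hL'
  have hL'mem : L' ∈ NTIME williamsBound := by
    refine mem_NTIME_of_prefixMachine_pre (rootClock (r + 1) 1)
      (fun x => (2 * cA + cq + 2) * williamsBound x.length + (2 * cA + cq + 2))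
      (acceptQ F ok out m c (dW + 3) (2 * (r + 1 + 1)) W₀ Y)
      (N.comp (mapFstAux RC))
      (P₁.comp ((mapFstAux A).comp (P₃.comp (MF.comp (complMachine (flagAux MS fun _ => [true]))))))
      (fun x => (cP * williamsBound x.length + cP + 3 * (2 * x.length + 2 + Y x.length) +
          2 * (2 * x.length + 2 + ((2 * cA + cq + 2) * williamsBound x.length + (2 * cA + cq + 2))) + 6) +
        (aN * ((2 * cA + cq + 2) * williamsBound x.length + (2 * cA + cq + 2)) + aN))
      (fun x => K * williamsBound x.length + K) ?_ ?_ (fun x => by rw [hL']; rfl) cB ?_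
    · -- the clock followed by the root clock on the first component
      intro x
      have h1 := hN x
      have h2 : RC.OutputsWithin
          (boolUnpair (boolPair x (List.replicate ((2 * cA + cq + 2) * williamsBound x.length +
            (2 * cA + cq + 2)) true))).1
          (rootClock (r + 1) 1 x) (cP * williamsBound x.length + cP) := by
        rw [boolUnpair_boolPair]
        exact (hRC x).mono (hcP x.length)
      have h3 := outputsWithin_mapFstAux RC h2
      rw [readRest_boolPair] at h3
      refine (TM2ComputableAux.comp_outputsWithin _ _ h1 h3).mono (le_of_eq ?_)
      simp only [rootClock, hY, length_boolPair, List.length_replicate]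
    · -- the core
      intro x z hz
      have hcore := core_outputsWithinQ hred (q := 2 * (r + 1 + 1)) (by omega) hP₁ hP₃ hA hsound hMF
        hFspec hMS Y (fun n hn => ?_) x z
      · exact hcore.mono (hK x.length z.length hz)
      · obtain ⟨h1, h2⟩ := hW₀ (succinctWidth c n) hn
        refine ⟨h1, le_trans ?_ h2⟩
        rw [hYeq]
        have := Nat.pow_le_pow_right two_pos
          (PolyExistsNTIME.nthRoot_mono_right (k := r + 1) (by omega) (le_succinctWidth c n))
        omega
    · -- the total is `O(williamsBound n)`
      intro x
      have := hcB x.length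
      simp only [rootClock, length_boolPair, List.length_replicate]
      omega
  -- `L` and `L'` agree on all inputs of length `≥ N₁`
  refine mem_NTIME_of_eqOn isTimeConstructible_williamsBound hL'mem N₁ fun x hx => ?_
  change x ∈ L ↔ ∃ z : List Bool,
    z.length ≤ (2 * cA + cq + 2) * williamsBound x.length + (2 * cA + cq + 2) ∧
      acceptQ F ok out m c (dW + 3) (2 * (r + 1 + 1)) W₀ Y x z = true
  constructor
  · intro hxL
    exact acceptQ_of_mem hred hm0 (q := 2 * (r + 1 + 1)) (by omega) hsound hcompl hWit hFspec Y
      (fun n hn => by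
        obtain ⟨h1, h2, h3⟩ := hN₁ n hn
        exact ⟨h1, h2, by rw [hYeq]; exact h3⟩)
      (fun x => (2 * cA + cq + 2) * williamsBound x.length + (2 * cA + cq + 2))
      (fun x => by
        have h1 := hcq x.length
        have e : (2 * cA + cq + 2) * williamsBound x.length =
            2 * (cA * williamsBound x.length) + cq * williamsBound x.length +
              2 * williamsBound x.length := by ring
        omega) hxL hx
  · rintro ⟨z, -, hacc⟩
    exact mem_of_acceptQ hred hsound hacc


/-! ### `NQP ⊄ ACC⁰` from the easy witness lemma alone -/

open Filter in
/-- **`NQP ⊄ ACC⁰` from the easy witness lemma for `NQP` alone.** Hypothesis `hEWL`: Murray–Williams'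
Lemma 1.3 at the tree's levels (for every `k ≥ 1`: if every language of every level
`NTIME (n ^ (log₂ n)^e)`, `e ≥ 1`, has circuits of size `2^{(log₂ n)^k}` almost everywhere, then from
some level on every level has witness circuits of size `2^{(log₂ n)^K}`), verbatim as in
`MurrayWilliams2018_NQP_not_subset_ACC0_of_EWL_of_machineB` (`MurrayWilliams2018Headline.lean`). The
other three ingredients of that reduction are now theorems: Williams' Fact 3.1
(`Williams2014_fact_3_1_holds`), the machine `B` at subexponential witness size
(`MurrayWilliams2018_machineB_subexp`) and Williams' Thm. 4.1 (`Williams2014_thm_4_1_holds`).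
[cite: MurrayWilliams2018, §1.1, Lemma 1.3 and Thm. 1.2–1.3 (proofs, §5); Williams2014, proof of Thm. 3.2 and of Thm. 1.1] -/
theorem MurrayWilliams2018_NQP_not_subset_ACC0_of_EWL
    (hEWL : ∀ k : ℕ, 1 ≤ k →
      (∀ e : ℕ, 1 ≤ e → ∀ L ∈ NTIME (fun n => n ^ Nat.log 2 n ^ e),
          ∀ᶠ n in atTop, L.circuitSize n ≤ 2 ^ Nat.log 2 n ^ k) →
        ∃ K e₀ : ℕ, 1 ≤ K ∧ ∀ e : ℕ, e₀ ≤ e →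
          NTIMEHasWitnessCircuits (fun n => n ^ Nat.log 2 n ^ e) (fun n => 2 ^ Nat.log 2 n ^ K)) :
    MurrayWilliams2018_NQP_not_subset_ACC0 :=
  MurrayWilliams2018_NQP_not_subset_ACC0_of_EWL_of_machineB hEWL Williams2014_fact_3_1_holds
    MurrayWilliams2018_machineB_subexp Williams2014_thm_4_1_holds

/-- **`NQP ⊄ ACC⁰` from the single named fact `MurrayWilliams2018_lemma_4_1_ae`** (Murray–Williams
2018, Lemma 4.1, the Easy Witness Lemma for low nondeterministic time, almost-everywhere form;
Lemma 1.3 by `MurrayWilliams2018_lemma_1_3_of_lemma_4_1_ae`). After this file the headline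
`MurrayWilliams2018_NQP_not_subset_ACC0` rests on that one fact.
[cite: MurrayWilliams2018, §1.1, Lemma 4.1 and Thm. 1.3] -/
theorem MurrayWilliams2018_NQP_not_subset_ACC0_of_lemma_4_1_ae (h41 : MurrayWilliams2018_lemma_4_1_ae) :
    MurrayWilliams2018_NQP_not_subset_ACC0 :=
  MurrayWilliams2018_NQP_not_subset_ACC0_of_lemma_4_1_ae_of_machineB h41 Williams2014_fact_3_1_holds
    MurrayWilliams2018_machineB_subexp Williams2014_thm_4_1_holds

end Literature.Computability.Complexity

end
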